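import Summits.AtomisticToContinuum.FouriersLaw.Theses.OddSectorIrreversibility
import Summits.AtomisticToContinuum.FouriersLaw.Theses.BoundaryEscapeDeficit
import Summits.AtomisticToContinuum.FouriersLaw.Theses.JunctionLocality
import Summits.AtomisticToContinuum.FouriersLaw.Theorems.OddSectorIrreversibilityBoundedResponseConvergesEscapeDeficitForm
import Summits.AtomisticToContinuum.FouriersLaw.Theorems.BondHeatUncertaintyPositiveOrInfiniteLimitSlots
import Summits.AtomisticToContinuum.FouriersLaw.Theorems.BondHeatUncertaintyPositiveOrInfiniteLimitSplit

/-!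
# `BoundedResponseConverges` (crux stmt-AtomisticToContinuum-9141) — the EXACT TWO-PIECE SPLIT, glue proved

Strategist file (`--supports stmt-AtomisticToContinuum-9141`, crux-strategist seat s1 on route
`OddSectorIrreversibility`; checked and landed verbatim — up to the fully-qualified header of the registered stub — by line lead c4). The crux is the rank-4 import slot "bounded clause-(ii) response ⇒ `D_N → k > 0`".
By the landed identity `responseCoeff_eq_escapeDeficit` every response coefficient of the crux's frame IS the
explicit equilibrium sequence `e_N = (N−1)·γ·E_N` (`E_N` the boundary escape deficit of route
`BoundaryEscapeDeficit`), so the crux's two printed failure modes — bounded OSCILLATION in `N` and the INSULATING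
limit `D_N → 0` (its own `why it might fail`, BLR2000 §6.3) — are exactly two EXISTING typed items of sibling routes:

* `BoundaryEscapeDeficit.EscapeNonOscillation` (stmt-AtomisticToContinuum-12238): `N ↦ (N−1)·γ·E_N` has a limit in
  `EReal` (liminf = limsup, no value claimed) — oscillation excluded;
* `JunctionLocality.ConductanceLowerBound` (stmt-AtomisticToContinuum-11749): `D_N ≥ c > 0` eventually — insulation
  excluded.

`boundedResponseConverges_of_subs : EscapeNonOscillation → ConductanceLowerBound → BoundedResponseConverges` is the
glue of the split `BoundedResponseConverges ⇐ EscapeNonOscillation ∧ ConductanceLowerBound`: along any steady family the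
`EReal` limit of `e_N` is the `EReal` limit of `D_N` (`N ≥ 1`); the crux's OWN hypothesis `BddAbove (range |D|)` caps it
from above and the floor from below, so it is a real number `k ≥ c > 0` and `D_N → k` (`EReal.coe_toReal`,
`EReal.tendsto_coe`). Both hypotheses of the crux that the disprover proved load-bearing are consumed here:
`BddAbove` (harmonic corner, `boundedResponseConverges_false_without_bddAbove_harmonic`: there `EscapeNonOscillation`
holds with limit `⊤` and the floor holds, only boundedness fails) and weak-NESS uniqueness (inside
`responseCoeff_eq_escapeDeficit`). Conversely, granted the route's sibling item `BoundedResponse` (10924), the crux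
implies both pieces (`conductanceLowerBound_of_boundedResponseConverges` in the crux's `Disproof.lean`; a convergent
real sequence has an `EReal` limit), so modulo 10924 the split is an equivalence — neither piece is the crux reworded,
and neither alone suffices (`boundedResponseConverges_skeleton_oscillating` / `_insulating`, Negative/LoadBearing).
Pure real analysis over landed identities; standard axioms.
-/

noncomputable section

open MeasureTheory Filter Topology Set

namespace Summit.AtomisticToContinuum.FouriersLaw.Theorems

open Literature.MathematicalPhysics.KineticTheory.HeatConduction
open Summit.AtomisticToContinuum.FouriersLaw.Theses

/-- **Sequence lemma.** A real sequence whose `EReal` image converges, which is bounded in absolute value and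
eventually above a positive floor `c`, converges in `ℝ` to some `k > 0` (`k ≥ c`). [folklore] -/
theorem exists_pos_tendsto_of_ereal_tendsto_of_abs_le_of_floor (D : ℕ → ℝ) {ℓ : EReal}
    (hℓ : Tendsto (fun N : ℕ => ((D N : ℝ) : EReal)) atTop (𝓝 ℓ))
    {B : ℝ} (hB : ∀ N, |D N| ≤ B) {c : ℝ} (hc : 0 < c) {N₁ : ℕ} (hfloor : ∀ N, N₁ ≤ N → c ≤ D N) :
    ∃ k : ℝ, 0 < k ∧ Tendsto D atTop (𝓝 k) := by
  have hℓ_le : ℓ ≤ ((B : ℝ) : EReal) :=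
    le_of_tendsto' hℓ fun N => EReal.coe_le_coe_iff.2 ((le_abs_self _).trans (hB N))
  have hev : ∀ᶠ N : ℕ in atTop, ((c : ℝ) : EReal) ≤ ((D N : ℝ) : EReal) :=
    (eventually_ge_atTop N₁).mono fun N hN => EReal.coe_le_coe_iff.2 (hfloor N hN)
  have hℓ_ge : ((c : ℝ) : EReal) ≤ ℓ := ge_of_tendsto hℓ hev
  have hℓ_top : ℓ ≠ ⊤ := ne_top_of_le_ne_top (EReal.coe_ne_top _) hℓ_le
  have hℓ_bot : ℓ ≠ ⊥ := ne_bot_of_le_ne_bot (EReal.coe_ne_bot _) hℓ_ge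
  refine ⟨ℓ.toReal, ?_, ?_⟩
  · rw [← EReal.coe_toReal hℓ_top hℓ_bot, EReal.coe_le_coe_iff] at hℓ_ge
    exact lt_of_lt_of_le hc hℓ_ge
  · rw [← EReal.coe_toReal hℓ_top hℓ_bot] at hℓ
    exact EReal.tendsto_coe.1 hℓ

/-- **The split glue `BoundedResponseConverges ⇐ EscapeNonOscillation ∧ ConductanceLowerBound`.** Along any
steady-state family of `pinnedChain ω₂ lam β γ` (all `> 0`) under weak-NESS uniqueness, at `T > 0`: the response
coefficients are the escape-deficit sequence `(N−1)·γ·E_N` for `N ≥ 1` (`responseCoeff_eq_escapeDeficit`), so the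
`EReal` limit of item 12238 is an `EReal` limit of `N ↦ D N`; the crux's boundedness hypothesis and the floor of
item 11749 make it a real limit `k ≥ c > 0`. [folklore] -/
theorem boundedResponseConverges_of_subs : Summit.AtomisticToContinuum.FouriersLaw.Theses.BoundaryEscapeDeficit.EscapeNonOscillation → Summit.AtomisticToContinuum.FouriersLaw.Theses.JunctionLocality.ConductanceLowerBound → Summit.AtomisticToContinuum.FouriersLaw.Theses.OddSectorIrreversibility.BoundedResponseConverges := by
  intro hNO hF ω₂ lam β γ hω hl hβ hγ hU μ hμ T hT D hD hbdd
  obtain ⟨c, hc, N₁, hfloor⟩ := hF ω₂ lam β γ hω hl hβ hγ hU μ hμ T hT D hD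
  have h := hNO ω₂ lam β γ hω hl hβ hγ T hT
  dsimp only at h
  obtain ⟨ℓ, hℓ⟩ := h
  -- the `EReal` limit of `e_N` is an `EReal` limit of `D` (they agree for `N ≥ 1`)
  have hℓD : Tendsto (fun N : ℕ => ((D N : ℝ) : EReal)) atTop (𝓝 ℓ) := by
    refine hℓ.congr' ?_
    filter_upwards [eventually_gt_atTop 0] with N hN
    rw [EReal.coe_eq_coe_iff, responseCoeff_eq_escapeDeficit hω hl hβ hγ hU μ hμ hT hN (hD N)]
    simp only [dif_pos hN]
  obtain ⟨B, hB⟩ := hbdd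
  have hB' : ∀ N, |D N| ≤ B := fun N => hB ⟨N, rfl⟩
  exact exists_pos_tendsto_of_ereal_tendsto_of_abs_le_of_floor D hℓD hB' hc hfloor

/-- The same glue with the floor first (argument order of `JunctionLocality`-side bridges). [folklore] -/
theorem boundedResponseConverges_of_conductanceLowerBound_of_escapeNonOscillation
    (hF : JunctionLocality.ConductanceLowerBound) (hNO : BoundaryEscapeDeficit.EscapeNonOscillation) :
    OddSectorIrreversibility.BoundedResponseConverges :=
  boundedResponseConverges_of_subs hNO hF

/-- **Exactness of the split modulo bounded response.** Granted the route's sibling item `BoundedResponse`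
(stmt-AtomisticToContinuum-10924, bounded response under weak-NESS uniqueness — the output of `WitnessGlue`), the crux
implies BOTH pieces: through the landed `positiveOrInfiniteLimit_of_boundedResponseConverges` (crux ∧ 10924 ⇒ the
sibling slot 9128, an `EReal` limit `ℓ > 0` of `D`), then `conductanceLowerBound_of_positiveOrInfiniteLimit` (11749) and
`escapeNonOscillation_of_positiveOrInfiniteLimit` (12238, fed with the PROVED `NessUnique_holds` and
`responseIdentity_proof`). So `BoundedResponse → (BoundedResponseConverges ↔ EscapeNonOscillation ∧ ConductanceLowerBound)`:
the two children are jointly equivalent to the parent on this route, and each is strictly weaker. First half: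
granted 10924, the crux gives non-oscillation (12238). [folklore] -/
theorem escapeNonOscillation_of_boundedResponse_of_boundedResponseConverges
    (hB : OddSectorIrreversibility.BoundedResponse) (hC : OddSectorIrreversibility.BoundedResponseConverges) :
    BoundaryEscapeDeficit.EscapeNonOscillation :=
  PositiveOrInfiniteLimit.escapeNonOscillation_of_positiveOrInfiniteLimit
    OddSectorIrreversibility.NessUnique_holds
    Summit.AtomisticToContinuum.FouriersLaw.Cruxes.SuperadditiveResistance.ThermaliseThenCutProbeInsertion.responseIdentity_proof
    (PositiveOrInfiniteLimit.positiveOrInfiniteLimit_of_boundedResponseConverges hC hB)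

/-- Second half of the exactness statement: granted `BoundedResponse` (10924), the crux gives the floor (11749) —
the landed `crux ∧ bounded response ⇒ 9128 ⇒ 11749` chain, by name. [folklore] -/
theorem conductanceLowerBound_of_boundedResponse_of_boundedResponseConverges
    (hB : OddSectorIrreversibility.BoundedResponse) (hC : OddSectorIrreversibility.BoundedResponseConverges) :
    JunctionLocality.ConductanceLowerBound :=
  PositiveOrInfiniteLimit.conductanceLowerBound_of_positiveOrInfiniteLimit
    (PositiveOrInfiniteLimit.positiveOrInfiniteLimit_of_boundedResponseConverges hC hB)

end Summit.AtomisticToContinuum.FouriersLaw.Theorems
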